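import Summits.Ventures.HSemireg.WedgeBox

/-!
# Venture HSemireg — the PER-`q` (Dolbeault-block) ranks of the box `θ ↦ θ ∧ (f₁ ∧ f₂)` in th-7's wedge model, 1/2:
# block projections, the one-block-per-term lemma, and «block rank = number of reachable monomials»

HONEST FRAMING. Part of the Lean index of the computation cell `pub-hsemireg` (seat p10 gen 2, Sunday typer «UNIFORM-IN-n»;
th-6's PER-q LAW of FORMULA-N PART A §4.1″ / STRUCTURE.md v1.0-SIGNED §1.1 C13 in th-7's model of `WedgeBox.lean`).  Finite-
dimensional EXTERIOR ALGEBRA over a field ONLY: no variety, no cohomology theory, no sheaf, no semiregularity map is constructed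
here; nothing here says that HC / HC_CM / HC_AV holds; no Literature fact is declared or used.

THE MODEL (th-7, `WedgeBox.lean`): generators `I n = Fin 4n` in four blocks `X = A 0`, `Y = A 1` (factor 1) and `X′ = C 0`,
`Y′ = C 1` (factor 2), monomial basis `E_T = B T` of `⋀ K^{4n}`, the box class `Σ_{α,β} c_{αβ} E_{A α ∪ C β}` (`boxClass c`; the
honest box `fac1 a * fac2 a′` has `c = boxCoeff a a′` with non-zero entries), and `wedgeMap k v = (θ ↦ θ ∧ v)` on `⋀^k`.  The
DICTIONARY (quoted from th-6 §4.1″ / th-7 PART B §A.3, NOT asserted): `X`-generators ↔ `V = H⁰(T_X)`-directions, `Y` ↔ `V̄* =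
H¹(𝒪_X)`, `θ ↦ θ ∧ E_X` ↔ `θ ↦ θ⌟1` (the GLOBAL component, target `H^{0,i}`, Dolbeault index `0`), `θ ↦ θ ∧ E_Y` ↔ `θ ↦ θ⌟pt`
(the LOCAL component, target `Hⁿ(Ω^{n−i})`, index `n − i`); so the Dolbeault index `q` of a target monomial `E_T` — the `q` of
the block `H^{q+m}(Ω^q_{X×X′})` it models — is the number of `X ∪ X′`-generators MISSING from `T`:
    `qdeg T := |(A 0 ∪ C 0) ∖ T|`   (`= (n − |T ∩ X|) + (n − |T ∩ X′|)`, additive over the two factors = Künneth).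
WHAT IS PROVED HERE (every field `K`, every `n ≥ 1`):
* `blockProj q` = the projection of `⋀ K^{4n}` onto `span{E_T : qdeg T = q}` along the other monomials; `qdeg_union_P`: for a source
  monomial `E_s` the term `c_{αβ} E_s ∧ E_{Aα ∪ Cβ}` of `E_s ∧ box` lies in block `[α = 1]·|X ∖ s| + [β = 1]·|X′ ∖ s|`;
* `eq_of_qdeg_eq` (ONE BLOCK PER TERM): for `s ≠ ∅` the (at most four) non-zero terms of `E_s ∧ box` lie in PAIRWISE DISTINCT
  blocks — so `blockProj q (E_s ∧ box)` is a single non-zero multiple of a monomial, or `0` (th-6: «the only multi-component source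
  vector is θ = 1 ∈ HT⁰» — here: `s = ∅` is exactly the excluded case);
* `range_blockProj_wedgeMap` / **`finrank_range_blockProj_wedgeMap_eq_card`**: for `k ≥ 1` and all four `c_{αβ} ≠ 0`, the range
  of `blockProj q ∘ (θ ↦ θ ∧ box)` on `⋀^k` is `span{E_T : T ∈ reach k q}` and its rank is `|reach k q|`, where `reach k q` = the
  monomials `T` of size `k + 2n` in block `q` containing some `Aα ∪ Cβ`.
The COUNT `|reach k q| = [t^k u^q] Q_n(t,u)²` (`FormulaN.Uniform.blockCount`, file `FormulaNUniformBlocks.lean`) is file 2/2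
(`WedgeBoxPerQCount.lean`).  Namespace `Summit.Ventures.HSemireg.WedgeBox` (th-7's, enclosure p3), new names only.
-/

open Module Set Set.powersetCard

namespace Summit.Ventures.HSemireg.WedgeBox

variable (K : Type*) [Field K] (n : ℕ)

/-- the Dolbeault block index of a target monomial `E_T`: the number of `X ∪ X′ = A 0 ∪ C 0 = P 0 0` generators missing from `T`
(dictionary: the `q` of `H^{q+m}(Ω^q_{X×X′})`; global components have all of `X`, local ones miss `n − i` of them). -/
def qdeg (T : Finset (I n)) : ℕ := (P n 0 0 \ T).card

/-- the projection onto the `q`-block `span{E_T : qdeg T = q}` along the complementary monomials. -/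
noncomputable def blockProj (q : ℕ) : HT K n →ₗ[K] HT K n :=
  (B K n).constr K fun T => if qdeg n T = q then B K n T else 0

/-- the monomials REACHABLE in degree `k`, block `q`: `|T| = k + 2n`, `qdeg T = q`, and `T ⊇ Aα ∪ Cβ` for some `α, β`
(then `T = s ⊔ (Aα ∪ Cβ)` with `|s| = k`, and `E_s ∧ box` has a non-zero term at `E_T`). -/
def reach (k q : ℕ) : Finset (Finset (I n)) :=
  Finset.univ.filter fun T => T.card = k + (n + n) ∧ qdeg n T = q ∧ ∃ α β, P n α β ⊆ T

variable {n}

/-- membership in `reach`. -/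
lemma mem_reach {k q : ℕ} {T : Finset (I n)} :
    T ∈ reach n k q ↔ T.card = k + (n + n) ∧ qdeg n T = q ∧ ∃ α β, P n α β ⊆ T := by
  simp [reach]

/-- the block projection on a monomial. -/
lemma blockProj_B (q : ℕ) (T : Finset (I n)) :
    blockProj K n q (B K n T) = if qdeg n T = q then B K n T else 0 := by
  rw [blockProj, Basis.constr_basis]

/-- the block projection of `E_s ∧ box`, term by term. -/
lemma blockProj_B_mul_boxClass {k : ℕ} (q : ℕ) (c : Fin 2 → Fin 2 → K) (s : powersetCard (I n) k) :
    blockProj K n q (B K n s * boxClass K n c) =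
      ∑ α, ∑ β, (c α β * sgn K s (Ppc n α β)) •
        (if qdeg n (s.val ∪ P n α β) = q then B K n (s.val ∪ P n α β) else 0) := by
  rw [B_mul_boxClass]
  simp only [map_sum, map_smul, blockProj_B]

/-! ### The block of each term of `E_s ∧ box` -/

/-- `X ∖ (s ∪ Aα ∪ Cβ)` is empty for `α = 0` and `X ∖ s` for `α = 1`. -/
lemma A0_sdiff_union_P (s : Finset (I n)) (α β : Fin 2) :
    A n 0 \ (s ∪ P n α β) = if α = 0 then ∅ else A n 0 \ s := by
  split_ifs with h
  · subst h
    exact Finset.sdiff_eq_empty_iff_subset.mpr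
      (fun i hi => Finset.mem_union_right _ (Finset.mem_union_left _ hi))
  · have hα : (0 : Fin 2) ≠ α := fun e => h e.symm
    have hd : Disjoint (A n 0) (P n α β) := by
      rw [P, Finset.disjoint_union_right]
      exact ⟨disjoint_A_A n hα, disjoint_A_C n 0 β⟩
    rw [Finset.sdiff_union_distrib, Finset.sdiff_eq_self_of_disjoint hd,
      Finset.inter_eq_left.mpr Finset.sdiff_subset]

/-- `X′ ∖ (s ∪ Aα ∪ Cβ)` is empty for `β = 0` and `X′ ∖ s` for `β = 1`. -/
lemma C0_sdiff_union_P (s : Finset (I n)) (α β : Fin 2) :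
    C n 0 \ (s ∪ P n α β) = if β = 0 then ∅ else C n 0 \ s := by
  split_ifs with h
  · subst h
    exact Finset.sdiff_eq_empty_iff_subset.mpr
      (fun i hi => Finset.mem_union_right _ (Finset.mem_union_right _ hi))
  · have hβ : (0 : Fin 2) ≠ β := fun e => h e.symm
    have hd : Disjoint (C n 0) (P n α β) := by
      rw [P, Finset.disjoint_union_right]
      exact ⟨(disjoint_A_C n α 0).symm, disjoint_C_C n hβ⟩
    rw [Finset.sdiff_union_distrib, Finset.sdiff_eq_self_of_disjoint hd,
      Finset.inter_eq_left.mpr Finset.sdiff_subset]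

/-- **the block of the `(α,β)` term**: `qdeg (s ∪ Aα ∪ Cβ) = [α = 1]·|X ∖ s| + [β = 1]·|X′ ∖ s|` (global factor components
contribute `0`, a local component on factor 1 contributes `n − |s ∩ X|`, on factor 2 `n − |s ∩ X′|`: the Künneth sum `q = q₁ + q₂`). -/
lemma qdeg_union_P (s : Finset (I n)) (α β : Fin 2) :
    qdeg n (s ∪ P n α β) =
      (if α = 0 then 0 else (A n 0 \ s).card) + (if β = 0 then 0 else (C n 0 \ s).card) := by
  unfold qdeg
  rw [show P n 0 0 = A n 0 ∪ C n 0 from rfl, Finset.union_sdiff_distrib, Finset.card_union_of_disjoint,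
    A0_sdiff_union_P, C0_sdiff_union_P]
  · split_ifs <;> simp
  · exact (disjoint_A_C n 0 0).mono Finset.sdiff_subset Finset.sdiff_subset

/-- **ONE BLOCK PER TERM**: for a non-empty source monomial `E_s` (`n ≥ 1`), two surviving terms of `E_s ∧ box` (i.e. with `s`
disjoint from `Aα ∪ Cβ` and from `Aα′ ∪ Cβ′`) in the SAME block are the same term.  (For `s = ∅` this fails: `E_{X ∪ Y′}` and
`E_{Y ∪ X′}` both have `qdeg = n` — th-6's excluded degree `m = 0`.) -/
lemma eq_of_qdeg_eq (hn : 0 < n) {s : Finset (I n)} (hs : s.Nonempty) {α β α' β' : Fin 2}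
    (hd : Disjoint s (P n α β)) (hd' : Disjoint s (P n α' β'))
    (h : qdeg n (s ∪ P n α β) = qdeg n (s ∪ P n α' β')) : α = α' ∧ β = β' := by
  rw [disjoint_P_iff] at hd hd'
  rw [qdeg_union_P, qdeg_union_P] at h
  -- `s ≠ ∅` is not disjoint from all four blocks
  have hcov : ¬ ((∀ γ, Disjoint s (A n γ)) ∧ ∀ δ, Disjoint s (C n δ)) := fun ⟨hA, hC⟩ => by
    obtain ⟨i, hi⟩ := hs
    rcases mem_cover n i with ⟨γ, hγ⟩ | ⟨δ, hδ⟩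
    · exact Finset.disjoint_left.mp (hA γ) hi hγ
    · exact Finset.disjoint_left.mp (hC δ) hi hδ
  have hallA : α ≠ α' → ∀ γ, Disjoint s (A n γ) := fun hne γ => by
    have : γ = α ∨ γ = α' := by omega
    rcases this with rfl | rfl
    · exact hd.1
    · exact hd'.1
  have hallC : β ≠ β' → ∀ δ, Disjoint s (C n δ) := fun hne δ => by
    have : δ = β ∨ δ = β' := by omega
    rcases this with rfl | rfl
    · exact hd.2
    · exact hd'.2
  have cardA : Disjoint s (A n 0) → (A n 0 \ s).card = n := fun h0 => by
    rw [Finset.sdiff_eq_self_of_disjoint h0.symm, card_A]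
  have cardC : Disjoint s (C n 0) → (C n 0 \ s).card = n := fun h0 => by
    rw [Finset.sdiff_eq_self_of_disjoint h0.symm, card_C]
  have hα : α = α' := by
    by_contra hne
    have hA := hallA hne
    have hβ : β = β' := by
      by_contra hne'
      exact hcov ⟨hA, hallC hne'⟩
    subst hβ
    rw [cardA (hA 0)] at h
    have hcases : α = 0 ∧ α' = 1 ∨ α = 1 ∧ α' = 0 := by omega
    rcases hcases with ⟨h1, h2⟩ | ⟨h1, h2⟩
    · subst h1; subst h2
      simp only [if_true, show (1 : Fin 2) ≠ 0 by decide, if_false] at h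
      omega
    · subst h1; subst h2
      simp only [if_true, show (1 : Fin 2) ≠ 0 by decide, if_false] at h
      omega
  subst hα
  refine ⟨rfl, ?_⟩
  by_contra hne
  rw [cardC (hallC hne 0)] at h
  have hcases : β = 0 ∧ β' = 1 ∨ β = 1 ∧ β' = 0 := by omega
  rcases hcases with ⟨h1, h2⟩ | ⟨h1, h2⟩
  · subst h1; subst h2
    simp only [if_true, show (1 : Fin 2) ≠ 0 by decide, if_false] at h
    omega
  · subst h1; subst h2
    simp only [if_true, show (1 : Fin 2) ≠ 0 by decide, if_false] at h
    omega

/-! ### The range of `blockProj q ∘ (θ ↦ θ ∧ box)` on `⋀^k` is spanned by the reachable monomials -/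

/-- a surviving term of `E_s ∧ box` (with `|s| = k`) lands on a reachable monomial of its own block. -/
lemma union_P_mem_reach {k : ℕ} {s : Finset (I n)} (hs : s.card = k) {α β : Fin 2}
    (hd : Disjoint s (P n α β)) : s ∪ P n α β ∈ reach n k (qdeg n (s ∪ P n α β)) := by
  rw [mem_reach]
  exact ⟨by rw [Finset.card_union_of_disjoint hd, hs, card_P], rfl, α, β, Finset.subset_union_right⟩

/-- a reachable monomial, written as `s ⊔ (Aα ∪ Cβ)`. -/
lemma exists_of_mem_reach {k q : ℕ} {T : Finset (I n)} (hT : T ∈ reach n k q) :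
    ∃ (α β : Fin 2) (s : Finset (I n)), s.card = k ∧ Disjoint s (P n α β) ∧ s ∪ P n α β = T := by
  obtain ⟨hcard, -, α, β, hP⟩ := mem_reach.mp hT
  refine ⟨α, β, T \ P n α β, ?_, Finset.sdiff_disjoint, Finset.sdiff_union_of_subset hP⟩
  rw [Finset.card_sdiff_of_subset hP, hcard, card_P]
  omega

variable {k : ℕ} (c : Fin 2 → Fin 2 → K)

/-- **`blockProj q (E_s ∧ box)` for `s ≠ ∅` is ONE term**: if `s` is disjoint from `Aα ∪ Cβ` and that term lies in block `q`,
then the whole block-`q` component of `E_s ∧ box` is `c_{αβ}·sgn · E_{s ∪ Aα ∪ Cβ}`. -/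
lemma blockProj_B_mul_boxClass_eq_single (hn : 0 < n) (hk : 0 < k) (q : ℕ) (s : powersetCard (I n) k)
    {α β : Fin 2} (hd : Disjoint s.val (P n α β)) (hq : qdeg n (s.val ∪ P n α β) = q) :
    blockProj K n q (B K n s * boxClass K n c) = (c α β * sgn K s (Ppc n α β)) • B K n (s.val ∪ P n α β) := by
  classical
  have hs : s.val.Nonempty := by
    rw [← Finset.card_pos, card_eq s]; exact hk
  rw [blockProj_B_mul_boxClass]
  have hterm : ∀ α' β', (c α' β' * sgn K s (Ppc n α' β')) •
      (if qdeg n (s.val ∪ P n α' β') = q then B K n (s.val ∪ P n α' β') else 0) =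
      if α' = α ∧ β' = β then (c α β * sgn K s (Ppc n α β)) • B K n (s.val ∪ P n α β) else 0 := by
    intro α' β'
    by_cases hd' : Disjoint s.val (P n α' β')
    · by_cases hq' : qdeg n (s.val ∪ P n α' β') = q
      · obtain ⟨h1, h2⟩ := eq_of_qdeg_eq hn hs hd' hd (hq'.trans hq.symm)
        subst h1; subst h2
        rw [if_pos hq', if_pos ⟨rfl, rfl⟩]
      · rw [if_neg hq', smul_zero, if_neg]
        rintro ⟨rfl, rfl⟩
        exact hq' hq
    · rw [sgn_of_not_disjoint K hd', mul_zero, zero_smul, if_neg]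
      rintro ⟨rfl, rfl⟩
      exact hd' hd
  simp_rw [hterm]
  rw [Finset.sum_eq_single α (fun α' _ hα' => by simp [hα']) (by simp),
    Finset.sum_eq_single β (fun β' _ hβ' => by simp [hβ']) (by simp)]
  simp

/-- **the range of `blockProj q ∘ (θ ↦ θ ∧ box)` on `⋀^k`** (`n ≥ 1`, `k ≥ 1`, all `c_{αβ} ≠ 0`) is the span of the reachable
monomials of degree `k`, block `q`. -/
theorem range_blockProj_wedgeMap (hn : 0 < n) (hk : 0 < k) (hc : ∀ α β, c α β ≠ 0) (q : ℕ) :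
    LinearMap.range (blockProj K n q ∘ₗ wedgeMap K n k (boxClass K n c)) =
      Submodule.span K (Set.range fun T : reach n k q => (B K n T.1 : HT K n)) := by
  classical
  apply le_antisymm
  · rw [LinearMap.range_comp, range_wedgeMap, Submodule.map_span, Submodule.span_le]
    rintro _ ⟨_, ⟨s, rfl⟩, rfl⟩
    rw [SetLike.mem_coe, blockProj_B_mul_boxClass]
    refine Submodule.sum_mem _ fun α _ => Submodule.sum_mem _ fun β _ => ?_
    by_cases hd : Disjoint s.val (P n α β)
    · split_ifs with hq
      · refine Submodule.smul_mem _ _ (Submodule.subset_span ⟨⟨s.val ∪ P n α β, ?_⟩, rfl⟩)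
        rw [← hq]
        exact union_P_mem_reach (card_eq s) hd
      · rw [smul_zero]; exact Submodule.zero_mem _
    · rw [sgn_of_not_disjoint K hd, mul_zero, zero_smul]
      exact Submodule.zero_mem _
  · rw [Submodule.span_le]
    rintro _ ⟨⟨T, hT⟩, rfl⟩
    obtain ⟨α, β, s, hs, hd, rfl⟩ := exists_of_mem_reach hT
    obtain ⟨-, hq, -⟩ := mem_reach.mp hT
    let spc : powersetCard (I n) k := ⟨s, by rw [mem_iff]; exact hs⟩
    have hcoef : c α β * sgn K spc (Ppc n α β) ≠ 0 :=
      mul_ne_zero (hc α β) ((sgn_ne_zero_iff K).mpr hd)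
    have himg : blockProj K n q (B K n spc * boxClass K n c) =
        (c α β * sgn K spc (Ppc n α β)) • B K n (s ∪ P n α β) :=
      blockProj_B_mul_boxClass_eq_single K c hn hk q spc hd hq
    have hmem : blockProj K n q (B K n spc * boxClass K n c) ∈
        LinearMap.range (blockProj K n q ∘ₗ wedgeMap K n k (boxClass K n c)) := by
      refine ⟨⟨B K n spc, B_mem_exteriorPower K spc⟩, ?_⟩
      rw [LinearMap.comp_apply, wedgeMap_apply]
    show B K n (s ∪ P n α β) ∈ LinearMap.range (blockProj K n q ∘ₗ wedgeMap K n k (boxClass K n c))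
    rw [← inv_smul_smul₀ hcoef (B K n (s ∪ P n α β)), ← himg]
    exact Submodule.smul_mem _ _ hmem

/-- **BLOCK RANK = NUMBER OF REACHABLE MONOMIALS**: for `n ≥ 1`, `k ≥ 1` and all `c_{αβ} ≠ 0`,
`rank(blockProj q ∘ (θ ↦ θ ∧ box) ∣ ⋀^k K^{4n}) = |reach n k q|`. -/
theorem finrank_range_blockProj_wedgeMap_eq_card (hn : 0 < n) (hk : 0 < k) (hc : ∀ α β, c α β ≠ 0) (q : ℕ) :
    finrank K (LinearMap.range (blockProj K n q ∘ₗ wedgeMap K n k (boxClass K n c))) = (reach n k q).card := by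
  have hli : LinearIndependent K (fun T : reach n k q => (B K n T.1 : HT K n)) :=
    (B K n).linearIndependent.comp (fun T : reach n k q => T.1) fun T T' h => Subtype.ext h
  rw [range_blockProj_wedgeMap K c hn hk hc q, finrank_span_eq_card hli, Fintype.card_coe]

end Summit.Ventures.HSemireg.WedgeBox
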